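import Summits.BirchSwinnertonDyer.BirchSwinnertonDyer.Theorems.EisensteinPrimesMazurMCOnCellBTwistbackTwoStepChain
import Summits.BirchSwinnertonDyer.BirchSwinnertonDyer.Theorems.EisensteinPrimesMazurMCOnCellBTwistbackSubrowPartnerAnyLinePAdicGZ
import Summits.BirchSwinnertonDyer.BirchSwinnertonDyer.Theorems.SchneiderFreeAdditiveX3PoitouTateSelmerDualityHolds
import Summits.BirchSwinnertonDyer.BirchSwinnertonDyer.Theorems.SchneiderFreeAdditiveX3PoitouTateShaDualityHolds
import Summits.BirchSwinnertonDyer.Rank1Residual.X2.IsogenyClassStability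
import Literature.NumberTheory.EllipticCurves.CyclotomicIwasawaMainTheoremIrreducibleBaseChangeProofs
import HarnessLib

/-!
# Crux 3 `MazurMCOnCellB` (stmt-BirchSwinnertonDyer-19033), line `twistback` v9 (LEAD x2-p1 g14): the crux BY NAME is a TREE
# theorem conditional on EXACTLY the v9 cone — `PublishedInputs` + EIGHT PUBLISHED named facts + Keller–Yin Thm. D (PRE)
# + the open stub 6⁗ `stub_upperPartnerOffSubrowNoReachableClassShaUnit` («(∃-PARTNER) at X2b pairs off the sub-row from
# whose isogeny class NO Ш-unit class is reachable by certified two-step chains»); and, PER PAIR, Mazur's main conjecture at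
# every X2b pair whose class REACHES a Ш-unit class, from the named facts alone

LEAD seat `bsd-line-x2-p1` g14 (2026-08-28; `--supports` stmt-BirchSwinnertonDyer-19033). THEOREMS ONLY: no `def`, no named
fact introduced, no `sorry`; every step is a by-name application of a landed tree theorem (width seats x2-p1-w6 g2/g3
p663790 / p667979 / `…TwistbackTwoStepChain`, x2-p1-w3 g11 p661280, cell bsd-schneider's Poitou–Tate `_holds`, the X2
isogeny-class stability file, Wuthrich 2014 Prop. 21's tree road).

WHAT.
* §1 `mazurMainConjectureAt_of_namedFacts_of_reachableClassShaUnit` — PER PAIR: at an X2b pair `(W, p)` with a curve `W₁ ~ W`,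
  a chain `Relation.ReflTransGen (TwoStepAt p) W₁ W″` (length ≥ 0; each edge = admissible `K` with `r_an(E^{(d_K)}) = 1`, a
  minimal model `Wd`, admissible `K″` for `Wd` with `L(Wd^{(d_{K″})},1) ≠ 0`, far end a minimal model of the double twist) and
  `Wc ~ W″` with `#Ш_an(Wc)` a rational `p`-unit: Mazur's main conjecture at `(W, p)` from `PublishedInputs`, Wuthrich Prop. 21,
  Hsieh, LZZ, Mazur Cor. 4.1 (PUBLISHED) and Keller–Yin Thm. D (PRE). The empty chain with `W₁ = W = W″ = Wc` is the tree's
  per-pair certificate road `X2.mazurMainConjectureAt_of_cellB_of_shaAn_unit` (no Keller–Yin needed there: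
  `mazurMainConjectureAt_of_namedFacts_of_classShaUnit`, §1, PUBLISHED only).
* §2 `mazurMCOnCellB_of_namedFacts_of_upperPartnerOffSubrowNoReachableClassShaUnit` — CRUX 3 BY NAME from EXACTLY the v9
  cone: `PublishedInputs` + {Disegni 2020 Thm. 4(1), Mazur Cor. 4.1, Hsieh 2014, LZZ 2018, Greenberg–Vatsal Thm. (3.11), Disegni
  2020 Thm. 2.4, Nakagawa–Horie–Taya, Wuthrich 2014 Prop. 21} + Keller–Yin Thm. D + 6⁗ (VERBATIM the registered v9 stub, as the
  hypothesis `hStub`) — the v9 skeleton's per-pair composition run on the Theorems side: Ш-unit class ↦ §1 (PUB); reachable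
  Ш-unit class ↦ §1; sub-row ↦ x2-p1-w3 g11's `upperPartner_at_three_of_balanceOne_of_padicGZ` + the per-pair door p663790;
  else `hStub` + p663790.

HONEST FRAMING: conditional theorems; the named facts enter exactly as labelled (PUBLISHED ×8 + the route's FACT item -19037;
Keller–Yin Thm. D is an UNREFEREED PREPRINT, arXiv:2402.12781v2 Thm. 5.1.3, flag `KYD-gap`); stub 6⁗ is OPEN as registered —
its excluded population («a Ш-unit class is reachable») is EXPECTED to be every X2b pair (idea-12 ANCHOR-CENSUS-g8: 46/46
computed classes reach one in ONE edge; x2-p1-w5 g3: the A10 target cell (70971a1, 3) reaches one via `(−131, −23)`) but is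
proved for NO infinite family (the supply statement `UnitAnchorSupply` is open in print: Vatsal 1999 Thm. 0.3 needs good
reduction and odd twists; Vatsal 2005 states Greenberg's Conj. 1.14 as open; Ono–Skinner exclude Eisenstein primes); no
registered stub is closed by this file; no summit statement, no Mazur main conjecture and no BSD is proved for any curve
unconditionally; 0 cells / labels / tiers move. BSD is not proved by any of this.

References: [KellerYin2024] Thm. D (PRE); [Wuthrich2014] Thm. 16, Prop. 21; [Disegni2020] Thm. 4, §2.2 Thm. 2.4;
[GreenbergVatsal2000] Thm. (1.3), §3 Thm. (3.11); [LiuZhangZhang2018] Thms. 1.5.1/1.5.3; [Hsieh2014] Thm. 1; [Mazur1978] Cor.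
4.1; [NakagawaHorie1988] Thm. 1; [MilneADT2006] I Thm. 4.10, I Thm. 7.3; [Miller2011LMS] Def. 1.1; [CastellaEtAl2021] Thm. 5.3.1.
-/

set_option autoImplicit false
-- `Summit.BirchSwinnertonDyer.BirchSwinnertonDyer.…`: the summit and its single sub-problem share a name.
set_option linter.dupNamespace false

noncomputable section

open scoped Classical MatrixGroups ModularForm

open CongruenceSubgroup WeierstrassCurve NumberField IsDedekindDomain Field
  Literature.NumberTheory.GaloisRepresentations
  Literature.NumberTheory.EllipticCurves
  Literature.NumberTheory.EllipticCurves.ModularForms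
  Literature.NumberTheory.QuadraticFields
  Literature.NumberTheory.EllipticCurves.Rank1Residual
  Literature.NumberTheory.EllipticCurves.Rank1Residual.Typed
  Literature.NumberTheory.EllipticCurves.Wuthrich2014
  Literature.NumberTheory.EllipticCurves.SteinWuthrich2013
  Literature.NumberTheory.EllipticCurves.GreenbergVatsal2000
  Literature.NumberTheory.EllipticCurves.Disegni2020
  Summit.BirchSwinnertonDyer.Rank1Residual
  Summit.BirchSwinnertonDyer.BirchSwinnertonDyer.Theses
  Summit.BirchSwinnertonDyer.BirchSwinnertonDyer.Theorems
  Summit.BirchSwinnertonDyer.BirchSwinnertonDyer.Theorems.EisensteinPrimesMazurMCOnCellBTwistbackTwoStepDefs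

namespace Summit.BirchSwinnertonDyer.BirchSwinnertonDyer.Theorems.EisensteinPrimesMazurMCOnCellBOfNamedFactsV9

/-! ## §1. Per pair: a Ш-unit class, or a REACHABLE Ш-unit class, closes the crux at `(W, p)` -/

/-- **PER PAIR, PUBLISHED inputs only: Mazur's main conjecture at an X2b pair whose `ℚ`-isogeny class carries a rational
`p`-unit `#Ш_an`.** `(W', p)` is X2b (`X2.cellB_iff_of_isIsogenous`, Tate uniformisation discharged), `L(W',1) ≠ 0`, Wuthrich
2014 Prop. 21 + GZK give `BSDp W' p` (`Wuthrich2014.bsdp_of_L_one_ne_zero_of_padicValRat_shaAn_eq_zero`), Cassels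
(`X2.bsdp_of_isIsogenous_of_bsdp`) and the exact converse (`X2.mazurMainConjectureAt_of_bsdp_of_red`). = the tree's
`X2.mazurMainConjectureAt_of_cellB_of_shaAn_unit` read on any isogenous minimal curve. Named facts: `PublishedInputs`
(Cassels, newforms, GZK, Wuthrich Thm. 16, Stein–Wuthrich, heights, Greenberg–Stevens), Wuthrich Prop. 21. CONDITIONAL.
[cite: Wuthrich2014, Prop. 21 (p. 400) and Thm. 16 (p. 397)] [cite: MilneADT2006, Thm. I.7.3] [cite: Miller2011LMS, Def. 1.1] -/
theorem mazurMainConjectureAt_of_namedFacts_of_classShaUnit (hP : EisensteinPrimes.PublishedInputs)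
    (hW21 : sha_dvd_analyticSha)
    (W : WeierstrassCurve ℚ) [W.IsElliptic] [W.IsGloballyMinimal] (p : ℕ) [Fact p.Prime] (hc : X2.CellB W p)
    (h0 : ∃ (W' : WeierstrassCurve ℚ) (_ : W'.IsElliptic) (_ : W'.IsGloballyMinimal),
      IsIsogenous W W' ∧ ∃ q : ℚ, shaAn W' = (q : ℂ) ∧ padicValRat p q = 0) :
    X2.MazurMainConjectureAt W p := by
  have hCassels := hP.2.1
  have hnf := hP.2.2.2.2.2.1
  have hGZK := hP.2.2.2.2.2.2.2.2.2.2.1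
  have hWu := hP.2.2.2.2.2.2.2.2.2.2.2.2.2.2.1
  have hJs := hP.2.2.2.2.2.2.2.2.2.2.2.2.2.2.2.1
  have hJn := hP.2.2.2.2.2.2.2.2.2.2.2.2.2.2.2.2.1
  have hHs := hP.2.2.2.2.2.2.2.2.2.2.2.2.2.2.2.2.2.1
  have hHn := hP.2.2.2.2.2.2.2.2.2.2.2.2.2.2.2.2.2.2.1
  have hGS := hP.2.2.2.2.2.2.2.2.2.2.2.2.2.2.2.2.2.2.2
  have hE : WeierstrassCurve.hasEntireLFunction_rat :=
    WeierstrassCurve.hasEntireLFunction_rat_of_exists_isNewformOf hnf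
  obtain ⟨W', _, _, hiso, hunit⟩ := h0
  have hc' : X2.CellB W' p :=
    (X2.cellB_iff_of_isIsogenous (p := p) TateCurve.Silverman1994_thmV53_tateUniformisation_holds
      TateCurve.Silverman1994_thmV53_corV54_tateUniformisation_holds hiso).mp hc
  have hL' : W'.entireLFunction 1 ≠ 0 := (W'.analyticRank_eq_zero_iff_holds (hE W')).1 hc'.1
  have hbsd' : BSDp W' p :=
    bsdp_of_L_one_ne_zero_of_padicValRat_shaAn_eq_zero hW21 hGZK W' p hc'.2.1.1 hL'
      (WeierstrassCurve.HasMultiplicativeReduction.not_hasAdditiveReduction (R := ℤ_[p]) hc'.2.1.2.2)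
      (Or.inl hc'.2.1.2.1) hunit
  have hbsd : BSDp W p :=
    X2.bsdp_of_isIsogenous_of_bsdp hCassels hGZK hE W' W hiso.symm_of_charZero p (by rw [hc'.1]; omega) hbsd'
  exact X2.mazurMainConjectureAt_of_bsdp_of_red hWu hJs hJn hHs hHn hGZK hE W p (hGS W p) hc.2.1.1 hc.2.1.2.2
    hc.2.1.2.1 hc.1 hbsd

/-- **PER PAIR: Mazur's main conjecture at an X2b pair whose isogeny class REACHES a Ш-unit class** along a finite chain of
certified two-step edges (`Relation.ReflTransGen (TwoStepAt p)`, x2-p1-w6 g3 `…TwistbackTwoStepDefs`), isogenies allowed at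
both ends. X2b travels along isogenies and the chain (`cellB_of_cellB_of_reflTransGen_twoStepAt`); Wuthrich Prop. 21 closes
`BSD_p(Wc)`; Cassels to `W″`; x2-p1-w6 g3's chain door `…TwistbackTwoStepChain.bsdp_of_cellB_of_reflTransGen_twoStepAt_of_bsdp`
(each edge = p663790's two-step transfer: crux 4's twist-partner door at `(Wd, K″)` with the LZZ value atom and Keller–Yin
Thm. D IMC atoms, then the per-pair core with STEP L) back to `W₁`; Cassels to `W`; exact converse. Named facts BY NAME:
`PublishedInputs`, Wuthrich Prop. 21, Poitou–Tate ×2 (TREE theorems, cell bsd-schneider), Hsieh, LZZ, Mazur Cor. 4.1, Keller–Yin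
Thm. D (PRE). CONDITIONAL; class-wide reachability is NOT claimed. [claim: KellerYin2024, status: under-review]
[cite: KellerYin2024, Thm. D = Thm. 5.1.3 (arXiv:2402.12781v2 L306–L309)] [cite: Wuthrich2014, Prop. 21 (p. 400)]
[cite: MilneADT2006, Thm. I.7.3] [cite: LiuZhangZhang2018, Thms. 1.5.1 and 1.5.3] [cite: Hsieh2014, Thm. 1] [cite: Mazur1978, Cor. 4.1] -/
theorem mazurMainConjectureAt_of_namedFacts_of_reachableClassShaUnit (hP : EisensteinPrimes.PublishedInputs)
    (hW21 : sha_dvd_analyticSha) (hMaz : mazur_not_dvd_maninConstant_of_odd)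
    (hH : hsieh2014_exists_anticyclotomicPAdicLFunction) (hF : LiuZhangZhang2018.thm151_thm153_modularCurve_heegnerVector)
    (hD : KellerYin2024.thmD_imcMult_exists_isBDPLFunction_isTorsion_charIdeal_eq_OPEN)
    (W : WeierstrassCurve ℚ) [W.IsElliptic] [W.IsGloballyMinimal] (p : ℕ) [Fact p.Prime] (hc : X2.CellB W p)
    (hR : ∃ (W₁ : WeierstrassCurve ℚ) (_ : W₁.IsElliptic) (_ : W₁.IsGloballyMinimal)
          (W'' : WeierstrassCurve ℚ) (_ : W''.IsElliptic) (_ : W''.IsGloballyMinimal)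
          (Wc : WeierstrassCurve ℚ) (_ : Wc.IsElliptic) (_ : Wc.IsGloballyMinimal),
          IsIsogenous W W₁ ∧ Relation.ReflTransGen (TwoStepAt p) W₁ W'' ∧ IsIsogenous W'' Wc ∧
          ∃ q : ℚ, shaAn Wc = (q : ℂ) ∧ padicValRat p q = 0) :
    X2.MazurMainConjectureAt W p := by
  have hCassels := hP.2.1
  have hnf := hP.2.2.2.2.2.1
  have hGZK := hP.2.2.2.2.2.2.2.2.2.2.1
  have hWu := hP.2.2.2.2.2.2.2.2.2.2.2.2.2.2.1
  have hJs := hP.2.2.2.2.2.2.2.2.2.2.2.2.2.2.2.1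
  have hJn := hP.2.2.2.2.2.2.2.2.2.2.2.2.2.2.2.2.1
  have hHs := hP.2.2.2.2.2.2.2.2.2.2.2.2.2.2.2.2.2.1
  have hHn := hP.2.2.2.2.2.2.2.2.2.2.2.2.2.2.2.2.2.2.1
  have hGS := hP.2.2.2.2.2.2.2.2.2.2.2.2.2.2.2.2.2.2.2
  have hE : WeierstrassCurve.hasEntireLFunction_rat :=
    WeierstrassCurve.hasEntireLFunction_rat_of_exists_isNewformOf hnf
  obtain ⟨W₁, _, _, W'', _, _, Wc, _, _, hiso₁, hchain, hisoc, hunit⟩ := hR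
  have hc₁ : X2.CellB W₁ p :=
    (X2.cellB_iff_of_isIsogenous (p := p) TateCurve.Silverman1994_thmV53_tateUniformisation_holds
      TateCurve.Silverman1994_thmV53_corV54_tateUniformisation_holds hiso₁).mp hc
  have hc'' : X2.CellB W'' p := cellB_of_cellB_of_reflTransGen_twoStepAt hE hc₁ hchain
  have hcc : X2.CellB Wc p :=
    (X2.cellB_iff_of_isIsogenous (p := p) TateCurve.Silverman1994_thmV53_tateUniformisation_holds
      TateCurve.Silverman1994_thmV53_corV54_tateUniformisation_holds hisoc).mp hc''
  have hLc : Wc.entireLFunction 1 ≠ 0 := (Wc.analyticRank_eq_zero_iff_holds (hE Wc)).1 hcc.1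
  have hbsdc : BSDp Wc p :=
    bsdp_of_L_one_ne_zero_of_padicValRat_shaAn_eq_zero hW21 hGZK Wc p hcc.2.1.1 hLc
      (WeierstrassCurve.HasMultiplicativeReduction.not_hasAdditiveReduction (R := ℤ_[p]) hcc.2.1.2.2)
      (Or.inl hcc.2.1.2.1) hunit
  have hbsd'' : BSDp W'' p :=
    X2.bsdp_of_isIsogenous_of_bsdp hCassels hGZK hE Wc W'' hisoc.symm_of_charZero p (by rw [hcc.1]; omega) hbsdc
  have hbsd₁ : BSDp W₁ p :=
    EisensteinPrimesMazurMCOnCellBTwistbackTwoStepChain.bsdp_of_cellB_of_reflTransGen_twoStepAt_of_bsdp hP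
      (fun K _ _ ↦ SchneiderFreeAdditiveX3.PoitouTateReduction.poitouTate_selmerStructure_duality_holds K)
      (fun K _ _ ↦ SchneiderFreeAdditiveX3.PoitouTateReduction.poitouTate_sha_tateDual_holds K)
      hH hF hMaz hD hc₁ hchain hbsd''
  have hbsd : BSDp W p :=
    X2.bsdp_of_isIsogenous_of_bsdp hCassels hGZK hE W₁ W hiso₁.symm_of_charZero p (by rw [hc₁.1]; omega) hbsd₁
  exact X2.mazurMainConjectureAt_of_bsdp_of_red hWu hJs hJn hHs hHn hGZK hE W p (hGS W p) hc.2.1.1 hc.2.1.2.2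
    hc.2.1.2.1 hc.1 hbsd

/-! ## §2. Crux 3 BY NAME from EXACTLY the v9 cone -/

/-- **CRUX 3 `MazurMCOnCellB` BY NAME from `PublishedInputs` + EIGHT PUBLISHED named facts + Keller–Yin Thm. D (PRE) + the
registered v9 open stub 6⁗ `stub_upperPartnerOffSubrowNoReachableClassShaUnit` (statement VERBATIM as `hStub`).** The v9
skeleton's per-pair composition on the Theorems side: at an X2b pair `(W, p)` — a Ш-unit class ↦ §1 (PUBLISHED only); a
REACHABLE Ш-unit class ↦ §1 (+ Thm. D); otherwise the partner field comes from the sub-row theorem (x2-p1-w3 g11 p661280,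
PUBLISHED inputs: Disegni Thm. 4(1), Greenberg–Vatsal (3.11), Disegni Thm. 2.4, Nakagawa–Horie–Taya) or from `hStub`, a
globally minimal model of the twist exists (`exists_isGloballyMinimal_smul_eq_quadraticTwist`), and x2-p1-w6 g2's per-pair
door p663790 `…OnePartnerAt.mazurMainConjectureAt_of_cellB_of_upper_partnerAt` concludes (STEP L = item -27489 ⟸ Thm. D +
Poitou–Tate + Hsieh + LZZ inside). Of the v8/v9 `stub_printedFacts` (8 conjuncts) ALL are consumed. CONDITIONAL on every
listed named fact and on the OPEN stub; nothing about any curve is proved unconditionally; BSD is not proved.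
[claim: KellerYin2024, status: under-review] [cite: KellerYin2024, Thm. D = Thm. 5.1.3] [cite: Disegni2020, Thm. 4 (§3.2) and §2.2 Thm. 2.4]
[cite: GreenbergVatsal2000, §3 Thm. (3.11) (p. 43)] [cite: NakagawaHorie1988, Thm. 1] [cite: Wuthrich2014, Prop. 21 (p. 400)]
[cite: LiuZhangZhang2018, Thms. 1.5.1 and 1.5.3] [cite: Hsieh2014, Thm. 1] [cite: Mazur1978, Cor. 4.1] [cite: Miller2011LMS, Def. 1.1] -/
theorem mazurMCOnCellB_of_namedFacts_of_upperPartnerOffSubrowNoReachableClassShaUnit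
    (hP : EisensteinPrimes.PublishedInputs) (hW21 : sha_dvd_analyticSha)
    (hDis : padicBSD_rankOne_nonsplitMult) (hMaz : mazur_not_dvd_maninConstant_of_odd)
    (hH : hsieh2014_exists_anticyclotomicPAdicLFunction) (hF : LiuZhangZhang2018.thm151_thm153_modularCurve_heegnerVector)
    (h311 : thm311_hasUnitContent_iff_and_order_eq_of_lineRamifiedEven)
    (hDGZ : Disegni2020.padicGrossZagier_nonsplitMult)
    (hNHT : Literature.NumberTheory.QuadraticFields.nakagawaHorie_taya_exists_imaginary_h3_eq_one)
    (hD : KellerYin2024.thmD_imcMult_exists_isBDPLFunction_isTorsion_charIdeal_eq_OPEN)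
    (hStub : ∀ (W : WeierstrassCurve ℚ) [W.IsElliptic] [W.IsGloballyMinimal] (p : ℕ) [Fact p.Prime],
      X2.CellB W p →
      ¬ (p = 3 ∧ ¬ W.HasSplitMultiplicativeReductionAtPrime 3 ∧
          ∃ (Φ₀ : AddSubgroup (geomTorsion W (3 : ℤ))) (m : ℕ) (_ : NeZero m) (φ : DirichletCharacter (ZMod 3) m)
            (d : ℕ) (_ : NeZero d) (ψ : DirichletCharacter (ZMod 3) d) (S₀ : Finset (HeightOneSpectrum (𝓞 ℚ))),
            IsRationalLine W 3 Φ₀ ∧ φ.IsPrimitive ∧ ψ.IsPrimitive ∧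
            (∀ (σ : absoluteGaloisGroup ℚ), ∀ P ∈ Φ₀,
              σ • P = (φ ((modNCyclotomicCharacter ℚ m σ : (ZMod m)ˣ) : ZMod m)).val • P) ∧
            (∀ (σ : absoluteGaloisGroup ℚ) (P : geomTorsion W (3 : ℤ)),
              σ • P - (ψ ((modNCyclotomicCharacter ℚ d σ : (ZMod d)ˣ) : ZMod d)).val • P ∈ Φ₀) ∧
            (∀ v ∈ S₀, ((3 : ℕ) : 𝓞 ℚ) ∉ v.asIdeal) ∧
            (∀ v : HeightOneSpectrum (𝓞 ℚ), v ∉ S₀ → ((3 : ℕ) : 𝓞 ℚ) ∉ v.asIdeal → W.HasGoodReductionAt v) ∧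
            1 + ∑ v ∈ S₀, delta W 3 v =
              ∑ v ∈ S₀, ((if φ (Rat.HeightOneSpectrum.natGenerator v : ZMod m) =
                    (Rat.HeightOneSpectrum.natGenerator v : ZMod 3)
                  then sFactor 3 (Rat.HeightOneSpectrum.natGenerator v) else 0) +
                (if ψ (Rat.HeightOneSpectrum.natGenerator v : ZMod d) =
                    (Rat.HeightOneSpectrum.natGenerator v : ZMod 3)
                  then sFactor 3 (Rat.HeightOneSpectrum.natGenerator v) else 0))) →
      ¬ (∃ (W₁ : WeierstrassCurve ℚ) (_ : W₁.IsElliptic) (_ : W₁.IsGloballyMinimal)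
          (W'' : WeierstrassCurve ℚ) (_ : W''.IsElliptic) (_ : W''.IsGloballyMinimal)
          (Wc : WeierstrassCurve ℚ) (_ : Wc.IsElliptic) (_ : Wc.IsGloballyMinimal),
          IsIsogenous W W₁ ∧ Relation.ReflTransGen (TwoStepAt p) W₁ W'' ∧ IsIsogenous W'' Wc ∧
          ∃ q : ℚ, shaAn Wc = (q : ℂ) ∧ padicValRat p q = 0) →
      ∃ (K : Type) (_ : Field K) (_ : NumberField K), IsImaginaryQuadratic K ∧
        SatisfiesHeegnerHypothesis (W.conductorNorm ℤ) K ∧ SatisfiesHeegnerHypothesis p K ∧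
        Odd (NumberField.discr K) ∧ NumberField.discr K < -4 ∧
        (W.quadraticTwist (NumberField.discr K : ℚ)).analyticRank = 1 ∧
        ∀ (Wd : WeierstrassCurve ℚ) [Wd.IsElliptic] [Wd.IsGloballyMinimal],
          (∃ C : VariableChange ℚ, C • Wd = W.quadraticTwist (NumberField.discr K : ℚ)) →
          MissingUpperBoundAt Wd p) :
    Summit.BirchSwinnertonDyer.BirchSwinnertonDyer.Theses.EisensteinPrimes.MazurMCOnCellB := by
  have hPT : ∀ (K : Type) [Field K] [NumberField K],
      Literature.NumberTheory.GaloisCohomology.poitouTate_selmerStructure_duality K :=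
    fun K _ _ ↦ SchneiderFreeAdditiveX3.PoitouTateReduction.poitouTate_selmerStructure_duality_holds K
  have hPT2 : ∀ (K : Type) [Field K] [NumberField K],
      Literature.NumberTheory.GaloisCohomology.poitouTate_sha_tateDual K :=
    fun K _ _ ↦ SchneiderFreeAdditiveX3.PoitouTateReduction.poitouTate_sha_tateDual_holds K
  unfold EisensteinPrimes.MazurMCOnCellB
  intro W _ _ p _ hc
  by_cases h0 : ∃ (W' : WeierstrassCurve ℚ) (_ : W'.IsElliptic) (_ : W'.IsGloballyMinimal),
      IsIsogenous W W' ∧ ∃ q : ℚ, shaAn W' = (q : ℂ) ∧ padicValRat p q = 0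
  · exact mazurMainConjectureAt_of_namedFacts_of_classShaUnit hP hW21 W p hc h0
  by_cases hR : ∃ (W₁ : WeierstrassCurve ℚ) (_ : W₁.IsElliptic) (_ : W₁.IsGloballyMinimal)
          (W'' : WeierstrassCurve ℚ) (_ : W''.IsElliptic) (_ : W''.IsGloballyMinimal)
          (Wc : WeierstrassCurve ℚ) (_ : Wc.IsElliptic) (_ : Wc.IsGloballyMinimal),
          IsIsogenous W W₁ ∧ Relation.ReflTransGen (TwoStepAt p) W₁ W'' ∧ IsIsogenous W'' Wc ∧
          ∃ q : ℚ, shaAn Wc = (q : ℂ) ∧ padicValRat p q = 0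
  · exact mazurMainConjectureAt_of_namedFacts_of_reachableClassShaUnit hP hW21 hMaz hH hF hD W p hc hR
  -- the partner field: sub-row theorem or the stub
  have hK : ∃ (K : Type) (_ : Field K) (_ : NumberField K), IsImaginaryQuadratic K ∧
        SatisfiesHeegnerHypothesis (W.conductorNorm ℤ) K ∧ SatisfiesHeegnerHypothesis p K ∧
        Odd (NumberField.discr K) ∧ NumberField.discr K < -4 ∧
        (W.quadraticTwist (NumberField.discr K : ℚ)).analyticRank = 1 ∧
        ∀ (Wd : WeierstrassCurve ℚ) [Wd.IsElliptic] [Wd.IsGloballyMinimal],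
          (∃ C : VariableChange ℚ, C • Wd = W.quadraticTwist (NumberField.discr K : ℚ)) →
          MissingUpperBoundAt Wd p := by
    by_cases hsub : p = 3 ∧ ¬ W.HasSplitMultiplicativeReductionAtPrime 3 ∧
          ∃ (Φ₀ : AddSubgroup (geomTorsion W (3 : ℤ))) (m : ℕ) (_ : NeZero m) (φ : DirichletCharacter (ZMod 3) m)
            (d : ℕ) (_ : NeZero d) (ψ : DirichletCharacter (ZMod 3) d) (S₀ : Finset (HeightOneSpectrum (𝓞 ℚ))),
            IsRationalLine W 3 Φ₀ ∧ φ.IsPrimitive ∧ ψ.IsPrimitive ∧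
            (∀ (σ : absoluteGaloisGroup ℚ), ∀ P ∈ Φ₀,
              σ • P = (φ ((modNCyclotomicCharacter ℚ m σ : (ZMod m)ˣ) : ZMod m)).val • P) ∧
            (∀ (σ : absoluteGaloisGroup ℚ) (P : geomTorsion W (3 : ℤ)),
              σ • P - (ψ ((modNCyclotomicCharacter ℚ d σ : (ZMod d)ˣ) : ZMod d)).val • P ∈ Φ₀) ∧
            (∀ v ∈ S₀, ((3 : ℕ) : 𝓞 ℚ) ∉ v.asIdeal) ∧
            (∀ v : HeightOneSpectrum (𝓞 ℚ), v ∉ S₀ → ((3 : ℕ) : 𝓞 ℚ) ∉ v.asIdeal → W.HasGoodReductionAt v) ∧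
            1 + ∑ v ∈ S₀, delta W 3 v =
              ∑ v ∈ S₀, ((if φ (Rat.HeightOneSpectrum.natGenerator v : ZMod m) =
                    (Rat.HeightOneSpectrum.natGenerator v : ZMod 3)
                  then sFactor 3 (Rat.HeightOneSpectrum.natGenerator v) else 0) +
                (if ψ (Rat.HeightOneSpectrum.natGenerator v : ZMod d) =
                    (Rat.HeightOneSpectrum.natGenerator v : ZMod 3)
                  then sFactor 3 (Rat.HeightOneSpectrum.natGenerator v) else 0))
    · obtain ⟨hp3, hns, hbal⟩ := hsub
      subst hp3
      exact EisensteinPrimesMazurMCOnCellBTwistbackSubrowPartnerAnyLinePAdicGZ.upperPartner_at_three_of_balanceOne_of_padicGZ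
        hP hDis h311 hDGZ hNHT W hc hns hbal
    · exact hStub W p hc hsub hR
  obtain ⟨K, _, _, hK, hHN, hHp, hodd, hlt, hr1, hU⟩ := hK
  have hd0 : (NumberField.discr K : ℚ) ≠ 0 := by exact_mod_cast NumberField.discr_ne_zero K
  obtain ⟨Wd, _, _, C, hC⟩ := exists_isGloballyMinimal_smul_eq_quadraticTwist W hd0
  exact EisensteinPrimesMazurMCOnCellBTwistbackOnePartnerAt.mazurMainConjectureAt_of_cellB_of_upper_partnerAt
    hP hPT hPT2 hH hF hMaz hD W p hc K hK hHN hHp hodd hlt hr1 Wd ⟨C, hC⟩ (hU Wd ⟨C, hC⟩)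

end Summit.BirchSwinnertonDyer.BirchSwinnertonDyer.Theorems.EisensteinPrimesMazurMCOnCellBOfNamedFactsV9

end
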